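import Summits.ResolutionOfSingularities.ResolutionOfSingularities.Theorems.PAlterationPialtSplitGlue
import Summits.ResolutionOfSingularities.ResolutionOfSingularities.Theorems.PAlterationPialtAbhyankarOpenRange
import Literature.AlgebraicGeometry.Resolution.RankOneReductionProofs
import Literature.AlgebraicGeometry.Resolution.LocalUniformizationAbhyankarPlaces
import Literature.AlgebraicGeometry.Resolution.ZariskiPatchingProperModels
import Literature.AlgebraicGeometry.Resolution.ProperModelsPatchingOfResolution
import Literature.AlgebraicGeometry.Resolution.FieldsJ2
import HarnessLib

/-!
# Crux `Pialt` (stmt-ResolutionOfSingularities-0555), line `SketchIdeator2` v5: the TEMKIN-FREE residual —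
# `Pialt` from relative local uniformization of RANK-ONE NON-ABHYANKAR valuations over perfect fields and
# two-model patching over perfect fields

Line lead c5 (prover-line-stmt-ResolutionOfSingularities-0555-c5-0, 2026-08-17), reshape of the registered
skeleton `Cruxes/Pialt/Lines/SketchIdeator2.lean` (v4 atoms: `stub_temkin2013`, `stub_rrLU1Perfect`,
`stub_twoModelPatchingPerfect`).

The v4 skeleton needed the named fact `Temkin2013` (Temkin 2013, Thm. 1.3.2 — undischarged; its in-tree leaf
`Temkin2013RelativeCurveSmoothFibre` is Berkovich-analytic) only because the local-uniformization atom was stated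
BELOW height-one Frobenius sandwiches (`stub_rrLU1Perfect`: Temkin supplies the regular model upstairs, the atom
descends it). Stating the LU atom directly on the function field, in the relative form of Novacoski–Spivakovsky
(`RelLocalUniformization k K O`, Def. 2.20), and feeding it through two theorems PROVED in the tree,

* `NovacoskiSpivakovsky2014_holds` (`RankOneReductionProofs.lean`): relative LU of all RANK-ONE valuation rings of all
  fields over `k` implies relative LU of every valuation ring (Novacoski–Spivakovsky 2014, Thm. 1.1), and
* `relLU_at_abhyankarPlace_of_perfectField` (`LocalUniformizationAbhyankarPlaces.lean`): relative LU at every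
  ABHYANKAR place of a function field over a perfect ground field (Knaf–Kuhlmann 2005, Thm. 1.1 + Cor. 2.2),

removes `Temkin2013` from the line altogether and sharpens the LU atom to its open core:

* `relLU_perfectField_of_rankOne_nonAbhyankar` — over a perfect field `k`: relative LU of the RANK-ONE,
  NON-ABHYANKAR valuation rings of the finitely generated `K/k` ⟹ relative LU of EVERY valuation ring of every `K/k`.
* `isLocallyUniformizable_of_relLocalUniformization` — relative ⟹ absolute LU (`IsLocallyUniformizable`).
* `rrLU1Perfect_of_relLURankOneNonAbhyankarPerfect` — hence the registered v4 atom `stub_rrLU1Perfect` (binders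
  verbatim) from the new atom, WITHOUT `Temkin2013` (the sandwich data `L, y, B` are idle).
* `hasResolution_perfectField_of_relLURankOneNonAbhyankar_of_twoModelPatchingPerfect` — the two atoms AT ONE perfect
  field `k` resolve every reduced separated `k`-scheme of finite type (Zariski–Piltant engine with proper models,
  `resolutionOverUpToDim_of_properPatching_of_relLU`).
* `relLU_of_forall_hasResolution`, `twoModelPatchingAt_of_forall_hasResolution`,
  `forall_hasResolution_perfectField_iff_atoms` — EXACTNESS field by field: over a perfect field `k`, resolution of
  every reduced separated `k`-scheme of finite type ⟺ (the LU atom at `k`) ∧ (two-model patching at `k`); so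
  nothing registered is stronger than resolution over perfect fields, and nothing weaker will do along this line.
* `pialt_of_relLURankOneNonAbhyankarPerfect_twoModelPatchingPerfect` — **`Pialt` from the two atoms in every prime
  characteristic** (hypotheses VERBATIM the registered v5 stubs `stub_relLURankOneNonAbhyankarPerfect`,
  `stub_twoModelPatchingPerfect`), via `pialt_of_forall_perfectField_hasResolution`.
* `relLURankOneNonAbhyankarPerfect_of_resolutionInChar`, `relLURankOneNonAbhyankarPerfect_of_resolutionOfSingularities`
  — the new atom is a consequence of resolution in characteristic `p`, hence of the summit.

References: J. Novacoski, M. Spivakovsky, *Reduction of local uniformization to the rank one case*, EMS Congr. Rep.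
(2014), Thm. 1.1; H. Knaf, F.-V. Kuhlmann, Ann. Sci. ÉNS 38 (2005), Thm. 1.1, Cor. 2.2; O. Piltant, RACSAM 107
(2013), Prop. 5.1, Cor. 5.7; M. Temkin, J. Algebra 373 (2013), §1.
-/

set_option linter.dupNamespace false

noncomputable section

open CategoryTheory AlgebraicGeometry
open Literature.AlgebraicGeometry.Resolution

namespace Summit.ResolutionOfSingularities.ResolutionOfSingularities.Theorems.Pialt.RadiciallyRegular

/-! ## The rank-one non-Abhyankar reduction of relative local uniformization over a perfect field -/

/-- **Relative local uniformization over a perfect field reduces to RANK-ONE, NON-ABHYANKAR valuations.** If, for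
the perfect field `k`, every rank-one valuation ring `O ⊇ k` of every finitely generated `K/k` which is NOT an
Abhyankar place of `K | k` admits relative local uniformization, then every valuation ring of every field over
`k` does: Novacoski–Spivakovsky's reduction to rank one (`NovacoskiSpivakovsky2014_holds`), the rank-one Abhyankar
places being uniformized by Knaf–Kuhlmann 2005 over a perfect ground field
(`relLU_at_abhyankarPlace_of_perfectField`); relative LU is vacuous unless `K/k` is finitely generated.
[cite: NovacoskiSpivakovsky2014, Thm. 1.1] [cite: KnafKuhlmann2005, Thm. 1.1 and Cor. 2.2] -/
theorem relLU_perfectField_of_rankOne_nonAbhyankar (k : Type) [Field k] [PerfectField k]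
    (h : ∀ (K : Type) [Field K] [Algebra k K] (O : ValuationSubring K),
      (⊤ : IntermediateField k K).FG → (∀ c : k, algebraMap k K c ∈ O) →
      Nonempty O.valuation.RankOne → ¬ IsAbhyankarPlace O (algebraMap k K).fieldRange ⊤ →
      RelLocalUniformization k K O)
    (K : Type) [Field K] [Algebra k K] (O : ValuationSubring K) :
    RelLocalUniformization k K O := by
  refine NovacoskiSpivakovsky2014_holds k ?_ K O
  intro K _ _ O hr1 R hRfg hRfr hRO
  have hKfg : (⊤ : IntermediateField k K).FG := by
    haveI : Algebra.FiniteType k R := R.fg_iff_finiteType.mp hRfg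
    exact IntermediateField.fg_top_of_isFractionRing_of_finiteType k R K
  have hkO : ∀ c : k, algebraMap k K c ∈ O := fun c => hRO (R.algebraMap_mem c)
  by_cases hA : IsAbhyankarPlace O (algebraMap k K).fieldRange ⊤
  · obtain ⟨A, hAO, hRA, hAfg, -, hreg⟩ :=
      relLU_at_abhyankarPlace_of_perfectField hKfg O hkO hA R hRfg hRO
    exact ⟨A, hAO, hRA, hAfg, hreg⟩
  · exact h K O hKfg hkO hr1 hA R hRfg hRfr hRO

/-- **Relative local uniformization implies (absolute) local uniformization** of a valuation ring `O ⊇ k` of a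
finitely generated `K/k`: apply it to any affine model of `K` inside `O` (`exists_affineModel`). [folklore] -/
theorem isLocallyUniformizable_of_relLocalUniformization {k K : Type} [Field k] [Field K] [Algebra k K]
    (O : ValuationSubring K) (hLU : RelLocalUniformization k K O)
    (hKfg : (⊤ : IntermediateField k K).FG) (hk : ∀ c : k, algebraMap k K c ∈ O) :
    IsLocallyUniformizable k K O := by
  obtain ⟨A₀, hA₀O, hA₀fg, hA₀fr⟩ := exists_affineModel k K hKfg O hk
  obtain ⟨A, hAO, hle, hAfg, hreg⟩ := hLU A₀ hA₀fg hA₀fr hA₀O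
  exact ⟨A, hAO, hAfg, isFractionRing_of_le hle hA₀fr, hreg⟩

/-- **Local uniformization of every valuation over a perfect field from the rank-one non-Abhyankar atom.**
[cite: NovacoskiSpivakovsky2014, Thm. 1.1] -/
theorem isLocallyUniformizable_perfectField_of_rankOne_nonAbhyankar (k : Type) [Field k] [PerfectField k]
    (h : ∀ (K : Type) [Field K] [Algebra k K] (O : ValuationSubring K),
      (⊤ : IntermediateField k K).FG → (∀ c : k, algebraMap k K c ∈ O) →
      Nonempty O.valuation.RankOne → ¬ IsAbhyankarPlace O (algebraMap k K).fieldRange ⊤ →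
      RelLocalUniformization k K O)
    (K : Type) [Field K] [Algebra k K] (hKfg : (⊤ : IntermediateField k K).FG)
    (O : ValuationSubring K) (hk : ∀ c : k, algebraMap k K c ∈ O) :
    IsLocallyUniformizable k K O :=
  isLocallyUniformizable_of_relLocalUniformization O
    (relLU_perfectField_of_rankOne_nonAbhyankar k h K O) hKfg hk

/-! ## The registered v4 atom `stub_rrLU1Perfect` without `Temkin2013` -/

/-- **The v4 LU atom `stub_rrLU1Perfect` from the rank-one non-Abhyankar atom, without Temkin's theorem.** If,
over every perfect field `k` of characteristic `p`, every rank-one non-Abhyankar valuation ring of every finitely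
generated `K/k` admits relative local uniformization, then for all height-one sandwich data `k ⊆ K ⊆ L`,
`B ⊆ O ⊆ L` the valuation ring `O ∩ K` of `K` is locally uniformizable over `k` — indeed EVERY valuation ring of
`K` containing `k` is (the sandwich data are idle). Conclusion binders verbatim those of the registered stub
`stub_rrLU1Perfect`. [cite: NovacoskiSpivakovsky2014, Thm. 1.1] -/
theorem rrLU1Perfect_of_relLURankOneNonAbhyankarPerfect {p : ℕ}
    (h : ∀ (k : Type) [Field k] [CharP k p] [PerfectField k] (K : Type) [Field K] [Algebra k K]
      (O : ValuationSubring K), (⊤ : IntermediateField k K).FG → (∀ c : k, algebraMap k K c ∈ O) →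
      Nonempty O.valuation.RankOne → ¬ IsAbhyankarPlace O (algebraMap k K).fieldRange ⊤ →
      RelLocalUniformization k K O) :
    ∀ (k K L : Type) [Field k] [CharP k p] [PerfectField k] [Field K] [Field L]
      [Algebra k K] [Algebra K L] [Algebra k L] [IsScalarTower k K L],
      (⊤ : IntermediateField k K).FG → IsPurelyInseparable K L →
      (∃ y : L, y ^ p ∈ (algebraMap K L).range ∧ IntermediateField.adjoin K {y} = ⊤) →
      ∀ B : Subalgebra k L, B.FG → IsFractionRing B L → IsRegularRing B →
      ∀ O : ValuationSubring L, B.toSubring ≤ O.toSubring →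
        IsLocallyUniformizable k K (O.comap (algebraMap K L)) := by
  intro k K L _ _ _ _ _ _ _ _ _ hKfg _ _ B _ _ _ O hBO
  exact isLocallyUniformizable_perfectField_of_rankOne_nonAbhyankar k (h k) K hKfg _
    (Pialt.OpenRange.algebraMap_mem_comap_of_subalgebra_le B O hBO)

/-! ## Resolution over one perfect field from the two atoms at that field, and exactness -/

/-- **The two atoms at a perfect field `k` resolve every reduced separated `k`-scheme of finite type**: relative
LU of every valuation ring over `k` (from the rank-one non-Abhyankar atom) and two-model patching of proper models
over `k` feed the Zariski–Piltant engine with proper models (`resolutionOverUpToDim_of_properPatching_of_relLU`;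
schemes of finite type over a field are finite-dimensional). [cite: Piltant2013, Prop. 5.1 and Cor. 5.7] -/
theorem hasResolution_perfectField_of_relLURankOneNonAbhyankar_of_twoModelPatchingPerfect (k : Type) [Field k]
    [PerfectField k]
    (hLU : ∀ (K : Type) [Field K] [Algebra k K] (O : ValuationSubring K),
      (⊤ : IntermediateField k K).FG → (∀ c : k, algebraMap k K c ∈ O) →
      Nonempty O.valuation.RankOne → ¬ IsAbhyankarPlace O (algebraMap k K).fieldRange ⊤ →
      RelLocalUniformization k K O)
    (hZ : ∀ (K : Type) [Field K] [Algebra k K] [Algebra.EssFiniteType k K], ∀ M₁ M₂ : ProperModel k K,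
      ∃ (N : ProperModel k K) (φ₁ : N.Hom M₁) (φ₂ : N.Hom M₂), φ₁.RegLe ∧ φ₂.RegLe)
    (X : Scheme.{0}) (f : X ⟶ Spec (.of k)) [IsSeparated f] [LocallyOfFiniteType f] [QuasiCompact f]
    [IsReduced X] : Scheme.HasResolution X := by
  haveI : CompactSpace X := QuasiCompact.compactSpace_of_compactSpace f
  obtain ⟨d, hd⟩ := exists_topologicalKrullDim_le_of_locallyOfFiniteType f
  exact resolutionOverUpToDim_of_properPatching_of_relLU hZ
    (fun K _ _ O R hRfg hRfr hRO =>
      relLU_perfectField_of_rankOne_nonAbhyankar k hLU K O R hRfg hRfr hRO)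
    d X f ‹_› ‹_› ‹_› ‹_› hd

/-- **Converse, LU half: resolution of every reduced separated `k`-scheme of finite type implies relative local
uniformization of every valuation ring over `k`** (resolve the affine model `Spec R`; the valuative criterion puts
a regular affine chart of the resolution inside `O`, `exists_affineModel_regular_of_hasResolution`). [folklore] -/
theorem relLU_of_forall_hasResolution (k : Type) [Field k]
    (hres : ∀ (X : Scheme.{0}) (f : X ⟶ Spec (.of k)), IsSeparated f → LocallyOfFiniteType f →
      QuasiCompact f → IsReduced X → Scheme.HasResolution X)
    (K : Type) [Field K] [Algebra k K] (O : ValuationSubring K) : RelLocalUniformization k K O := by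
  intro R hfg hfr hRO
  haveI : Algebra.FiniteType k R := R.fg_iff_finiteType.mp hfg
  refine exists_affineModel_regular_of_hasResolution O R hRO hfg hfr ?_
  let g : Spec (.of R) ⟶ Spec (.of k) := Spec.map (CommRingCat.ofHom (algebraMap k R))
  haveI : LocallyOfFiniteType g :=
    (HasRingHomProperty.Spec_iff (P := @LocallyOfFiniteType)).mpr
      (RingHom.finiteType_algebraMap.mpr ‹_›)
  exact hres (Spec (.of R)) g inferInstance inferInstance inferInstance inferInstance

/-- **Converse, patching half: resolution of every reduced separated `k`-scheme of finite type implies two-model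
patching of proper models over `k`** (resolve the join `M₁ ⋈ M₂`; a regular model is `RegLe` over both).
[folklore] -/
theorem twoModelPatchingAt_of_forall_hasResolution (k : Type) [Field k]
    (hres : ∀ (X : Scheme.{0}) (f : X ⟶ Spec (.of k)), IsSeparated f → LocallyOfFiniteType f →
      QuasiCompact f → IsReduced X → Scheme.HasResolution X)
    (K : Type) [Field K] [Algebra k K] [Algebra.EssFiniteType k K] (M₁ M₂ : ProperModel k K) :
    ∃ (N : ProperModel k K) (φ₁ : N.Hom M₁) (φ₂ : N.Hom M₂), φ₁.RegLe ∧ φ₂.RegLe := by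
  obtain ⟨N, φ, hN⟩ := (ProperModel.join M₁ M₂).exists_hom_isRegular_of_hasResolution
    (hres _ (ProperModel.join M₁ M₂).π inferInstance inferInstance inferInstance inferInstance)
  exact ⟨N, φ.comp (ProperModel.joinFst M₁ M₂), φ.comp (ProperModel.joinSnd M₁ M₂), fun y _ => hN y,
    fun y _ => hN y⟩

/-- **EXACTNESS of the v5 residual, field by field.** Over a perfect field `k`: resolution of every reduced
separated `k`-scheme of finite type ⟺ (relative LU of the rank-one non-Abhyankar valuation rings of the finitely
generated `K/k`) ∧ (two-model patching of proper models over `k`). [cite: Piltant2013, Prop. 5.1 and Cor. 5.7] -/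
theorem forall_hasResolution_perfectField_iff_atoms (k : Type) [Field k] [PerfectField k] :
    (∀ (X : Scheme.{0}) (f : X ⟶ Spec (.of k)), IsSeparated f → LocallyOfFiniteType f →
      QuasiCompact f → IsReduced X → Scheme.HasResolution X) ↔
    ((∀ (K : Type) [Field K] [Algebra k K] (O : ValuationSubring K),
      (⊤ : IntermediateField k K).FG → (∀ c : k, algebraMap k K c ∈ O) →
      Nonempty O.valuation.RankOne → ¬ IsAbhyankarPlace O (algebraMap k K).fieldRange ⊤ →
      RelLocalUniformization k K O) ∧
    (∀ (K : Type) [Field K] [Algebra k K] [Algebra.EssFiniteType k K], ∀ M₁ M₂ : ProperModel k K,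
      ∃ (N : ProperModel k K) (φ₁ : N.Hom M₁) (φ₂ : N.Hom M₂), φ₁.RegLe ∧ φ₂.RegLe)) := by
  constructor
  · intro hres
    exact ⟨fun K _ _ O _ _ _ _ => relLU_of_forall_hasResolution k hres K O,
      fun K _ _ _ M₁ M₂ => twoModelPatchingAt_of_forall_hasResolution k hres K M₁ M₂⟩
  · rintro ⟨hLU, hZ⟩ X f hs hl hq hr
    haveI := hs; haveI := hl; haveI := hq; haveI := hr
    exact hasResolution_perfectField_of_relLURankOneNonAbhyankar_of_twoModelPatchingPerfect k hLU hZ X f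

/-! ## The crux from the two atoms -/

/-- **`Pialt` from the TWO Temkin-free atoms**: relative local uniformization of rank-one non-Abhyankar valuations
over perfect fields and two-model patching of proper models over perfect fields, in every prime characteristic,
imply the crux `Pialt` (resolve over perfect fields, then a resolution is a purely inseparable regular alteration
and imperfect ground fields descend from the perfect closure: `pialt_of_forall_perfectField_hasResolution`). The two
hypotheses are VERBATIM the registered stubs `stub_relLURankOneNonAbhyankarPerfect` and
`stub_twoModelPatchingPerfect` of skeleton v5 of `Cruxes/Pialt/Lines/SketchIdeator2.lean`.
[cite: NovacoskiSpivakovsky2014, Thm. 1.1] [cite: Piltant2013, Prop. 5.1] [cite: Temkin2013, §1 (i), (iii)] -/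
theorem pialt_of_relLURankOneNonAbhyankarPerfect_twoModelPatchingPerfect
    (hLU : ∀ p : ℕ, p.Prime → ∀ (k : Type) [Field k] [CharP k p] [PerfectField k] (K : Type) [Field K]
      [Algebra k K] (O : ValuationSubring K), (⊤ : IntermediateField k K).FG →
      (∀ c : k, algebraMap k K c ∈ O) → Nonempty O.valuation.RankOne →
      ¬ IsAbhyankarPlace O (algebraMap k K).fieldRange ⊤ → RelLocalUniformization k K O)
    (hZ : ∀ p : ℕ, p.Prime → ∀ (k : Type) [Field k] [CharP k p] [PerfectField k] (K : Type) [Field K]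
      [Algebra k K] [Algebra.EssFiniteType k K], ∀ M₁ M₂ : ProperModel k K,
        ∃ (N : ProperModel k K) (φ₁ : N.Hom M₁) (φ₂ : N.Hom M₂), φ₁.RegLe ∧ φ₂.RegLe) :
    Summit.ResolutionOfSingularities.ResolutionOfSingularities.Theses.PAlteration.Pialt :=
  pialt_of_forall_perfectField_hasResolution fun p hp k _ _ _ X f hs hl hq hi => by
    haveI := hs; haveI := hl; haveI := hq; haveI := hi
    exact hasResolution_perfectField_of_relLURankOneNonAbhyankar_of_twoModelPatchingPerfect k (hLU p hp k)
      (hZ p hp k) X f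

/-! ## Warrants: the new atom is a consequence of resolution in characteristic `p`, hence of the summit -/

/-- The rank-one non-Abhyankar LU atom over perfect fields of characteristic `p` follows from resolution in
characteristic `p` (`ResolutionInChar.relLocalUniformization`; rank, Abhyankar-ness and perfectness idle).
[folklore] -/
theorem relLURankOneNonAbhyankarPerfect_of_resolutionInChar {p : ℕ} (h : ResolutionInChar.{0} p) :
    ∀ (k : Type) [Field k] [CharP k p] [PerfectField k] (K : Type) [Field K] [Algebra k K]
      (O : ValuationSubring K), (⊤ : IntermediateField k K).FG → (∀ c : k, algebraMap k K c ∈ O) →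
      Nonempty O.valuation.RankOne → ¬ IsAbhyankarPlace O (algebraMap k K).fieldRange ⊤ →
      RelLocalUniformization k K O :=
  fun k _ _ _ K _ _ O _ _ _ _ => h.relLocalUniformization k K O

/-- The rank-one non-Abhyankar LU atom, in every prime characteristic, follows from the summit
`ResolutionOfSingularities`. [folklore] -/
theorem relLURankOneNonAbhyankarPerfect_of_resolutionOfSingularities (h : _root_.ResolutionOfSingularities)
    (p : ℕ) (hp : p.Prime) :
    ∀ (k : Type) [Field k] [CharP k p] [PerfectField k] (K : Type) [Field K] [Algebra k K]
      (O : ValuationSubring K), (⊤ : IntermediateField k K).FG → (∀ c : k, algebraMap k K c ∈ O) →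
      Nonempty O.valuation.RankOne → ¬ IsAbhyankarPlace O (algebraMap k K).fieldRange ⊤ →
      RelLocalUniformization k K O :=
  relLURankOneNonAbhyankarPerfect_of_resolutionInChar (h p hp)

end Summit.ResolutionOfSingularities.ResolutionOfSingularities.Theorems.Pialt.RadiciallyRegular

end
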